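import Summits.ResolutionOfSingularities.ResolutionOfSingularities.Theorems.FrobeniusLadderFInjectiveMacaulayficationPencilBlowupLocalCharts
import HarnessLib

/-!
# BED Ω, GLOBAL PATCH (g-b), F6 GLUE AT THE STALK, PRINCIPAL BRANCH: `𝒥(W) = γ·(u, v)` with `u` a UNIT AT THE POINT `x = τ s` ⇒ FULL / CM pass from `𝒪_{X̃, x}` to `𝒪_{S′, s}`
# (restrict to the basic open `W ∩ D(u)`, where `𝒥 = (γ)`; ✓ `PencilBlowupLocalCharts.fullCl_stalk_of_principal`) — the tag-0 orbits of the cure fan (`g14/F6-ARCHITECTURE.md` (2), principal)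
# (crux `FInjectiveMacaulayfication` stmt-ResolutionOfSingularities-15315, chain w45a; seat res-L1-w45a-stub-3 g14)

[OURS · L1 W4.5a] Support file (`--supports stmt-ResolutionOfSingularities-15315 --as helper`); theorems only; GENERIC; no named fact; NOT a statement of any manuscript; nothing of the crux is
proved. AI-written (AI review is weaker than expert review).
* `ideal_affineBasicOpen_of_pair_unit` — on `D(u) ⊂ W`: `𝒥(D(u)) = (γ|_{D(u)})`, and `γ|_{D(u)}` stays a non-zero-divisor (✓ Mathlib `IsLocalization.nonZeroDivisors_le_comap`);
* ★★ `fullCl_stalk_of_pair_unit` / `cmCl_stalk_of_pair_unit` — `u_x` a unit (`x ∈ D(u)`, ✓ `Scheme.mem_basicOpen`) ⇒ `FullCl p 𝒪_{X̃,x} → FullCl p 𝒪_{S′,s}` (resp. CM) for `s` over `x`.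
[cite: StacksProject, Tag 02OS, Tag 01HR; GortzWedhorn2020, (13.19)]
-/

set_option linter.dupNamespace false

noncomputable section

open AlgebraicGeometry CategoryTheory Literature.AlgebraicGeometry.Resolution

namespace Summit.ResolutionOfSingularities.ResolutionOfSingularities.Theorems.FInjectiveMacaulayfication.PrincipalStalkPackage

open Summit.ResolutionOfSingularities.ResolutionOfSingularities.Theorems.FInjectiveMacaulayfication
open SliceableCentre PencilBlowupLocalCharts

variable {Xt S' : Scheme.{0}} {τ : S' ⟶ Xt} {𝒥 : Xt.IdealSheafData}

/-- On the basic open `D(u) ⊂ W`: `𝒥(D(u)) = (γ|_{D(u)})` with `γ|_{D(u)}` a non-zero-divisor. [OURS · F6 glue; cite: StacksProject, Tag 01HR] -/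
theorem ideal_affineBasicOpen_of_pair_unit (W : Xt.affineOpens) (γ u v : Γ(Xt, W)) (h𝒥 : 𝒥.ideal W = Ideal.span {γ * u, γ * v})
    (hγ : γ ∈ nonZeroDivisors Γ(Xt, W)) :
    𝒥.ideal (Xt.affineBasicOpen u) = Ideal.span {(Xt.presheaf.map (homOfLE (Xt.basicOpen_le u)).op).hom γ} ∧
      (Xt.presheaf.map (homOfLE (Xt.basicOpen_le u)).op).hom γ ∈ nonZeroDivisors Γ(Xt, Xt.affineBasicOpen u) := by
  have hu : IsUnit ((Xt.presheaf.map (homOfLE (Xt.basicOpen_le u)).op).hom u) := RingedSpace.isUnit_res_basicOpen Xt.toLocallyRingedSpace.toRingedSpace u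
  refine ⟨?_, ?_⟩
  · rw [← 𝒥.map_ideal_basicOpen W u, h𝒥, Ideal.map_span, Set.image_pair, map_mul, map_mul, Ideal.span_insert,
      Ideal.span_singleton_mul_right_unit hu]
    exact sup_eq_left.mpr (Ideal.span_singleton_le_span_singleton.mpr (dvd_mul_right _ _))
  · haveI := W.2.isLocalization_basicOpen u
    exact IsLocalization.nonZeroDivisors_le_comap (Submonoid.powers u) Γ(Xt, Xt.basicOpen u) hγ

/-- ★★ **FULL AT A POINT OVER WHICH THE PENCIL IS PRINCIPAL**: `𝒥(W) = (γu, γv)`, `γ` regular, and `u` a unit at `x = τ s` (`x ∈ D(u)`) ⇒ `FullCl p 𝒪_{X̃, x} → FullCl p 𝒪_{S′, s}`.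
[OURS · F6 glue at the stalk, principal branch; cite: StacksProject, Tag 02OS] -/
theorem fullCl_stalk_of_pair_unit (p : ℕ) (hτ : IsBlowup τ 𝒥) (W : Xt.affineOpens) (γ u v : Γ(Xt, W)) (h𝒥 : 𝒥.ideal W = Ideal.span {γ * u, γ * v})
    (hγ : γ ∈ nonZeroDivisors Γ(Xt, W)) (s : S') (hs : τ.base s ∈ Xt.basicOpen u) (hX : FullCl p (Xt.presheaf.stalk (τ.base s))) :
    FullCl p (S'.presheaf.stalk s) := by
  obtain ⟨h1, h2⟩ := ideal_affineBasicOpen_of_pair_unit W γ u v h𝒥 hγ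
  exact fullCl_stalk_of_principal p hτ (Xt.affineBasicOpen u) _ h1 h2 s hs hX

/-- The CM clause alone, same shape. [OURS · F6 glue at the stalk, principal branch] -/
theorem cmCl_stalk_of_pair_unit (hτ : IsBlowup τ 𝒥) (W : Xt.affineOpens) (γ u v : Γ(Xt, W)) (h𝒥 : 𝒥.ideal W = Ideal.span {γ * u, γ * v})
    (hγ : γ ∈ nonZeroDivisors Γ(Xt, W)) (s : S') (hs : τ.base s ∈ Xt.basicOpen u) (hX : CMCl (Xt.presheaf.stalk (τ.base s))) :
    CMCl (S'.presheaf.stalk s) := by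
  obtain ⟨h1, h2⟩ := ideal_affineBasicOpen_of_pair_unit W γ u v h𝒥 hγ
  exact cmCl_stalk_of_principal hτ (Xt.affineBasicOpen u) _ h1 h2 s hs hX

/-- The unit condition from the germ: `u_x` a unit in `𝒪_{X̃,x}` ⇒ `x ∈ D(u)`. [plumbing; cite: StacksProject, Tag 01HR] -/
theorem mem_basicOpen_of_isUnit_germ (W : Xt.affineOpens) (u : Γ(Xt, W)) (x : Xt) (hx : x ∈ (W : Xt.Opens))
    (hu : IsUnit ((Xt.presheaf.germ W x hx).hom u)) : x ∈ Xt.basicOpen u :=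
  (Xt.mem_basicOpen u x hx).mpr hu

end Summit.ResolutionOfSingularities.ResolutionOfSingularities.Theorems.FInjectiveMacaulayfication.PrincipalStalkPackage

end
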